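import Mathlib
import Summits.Ventures.PercRepro2.Graph

/-!
# Computable connectivity for kernel evaluation (blind cell PercRepro2, typer-1 g45, 2026-08-27)

`Conn ends ω u v` (`Reachable` in the open subgraph, `Graph.lean`) is decidable through Mathlib's
walk enumeration — far too slowly for the kernel.  With the edges given as ordered pairs
`pairs : E → V × V` (`ends e = s((pairs e).1, (pairs e).2)`), `reachSet pairs ω u` computes the
open cluster of `u` by `card V` closure steps on finsets, and

* `conn_iff_mem_reachSet : Conn ends ω u v ↔ v ∈ reachSet pairs ω u`

(soundness by induction on the closure steps, completeness through a path of length `< card V`,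
`SimpleGraph.Walk.toPath` / `IsPath.length_lt`).  Written for the kernel refutation of (TRI-o)
(`TypedBasesStarRefutation.lean`, night-3 g15's witness).  Own work; standard axioms.
-/

namespace Summit.Ventures.PercRepro2

section ConnReach

variable {V : Type*} {E : Type*} [Fintype V] [DecidableEq V] [Fintype E]

/-- The open neighbours of `u`: the other ends of the open edges at `u`. -/
def openNbrs (pairs : E → V × V) (ω : Config E) (u : V) : Finset V :=
  (Finset.univ.filter fun e => ω e = true ∧ ((pairs e).1 = u ∨ (pairs e).2 = u)).image
    fun e => if (pairs e).1 = u then (pairs e).2 else (pairs e).1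

/-- One closure step: `S` together with the open neighbours of its members. -/
def reachStep (pairs : E → V × V) (ω : Config E) (S : Finset V) : Finset V :=
  S ∪ S.biUnion (openNbrs pairs ω)

/-- The computable open cluster of `u`: `card V` closure steps from `{u}`. -/
def reachSet (pairs : E → V × V) (ω : Config E) (u : V) : Finset V :=
  (reachStep pairs ω)^[Fintype.card V] {u}

omit [Fintype V] in
/-- Membership in the open neighbours. -/
lemma mem_openNbrs {pairs : E → V × V} {ω : Config E} {u v : V} :
    v ∈ openNbrs pairs ω u ↔
      ∃ e, ω e = true ∧ ((pairs e).1 = u ∧ (pairs e).2 = v ∨ (pairs e).1 = v ∧ (pairs e).2 = u) := by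
  unfold openNbrs
  simp only [Finset.mem_image, Finset.mem_filter, Finset.mem_univ, true_and]
  constructor
  · rintro ⟨e, ⟨he, h1 | h2⟩, hv⟩
    · rw [if_pos h1] at hv
      exact ⟨e, he, Or.inl ⟨h1, hv⟩⟩
    · by_cases h1 : (pairs e).1 = u
      · rw [if_pos h1] at hv
        exact ⟨e, he, Or.inl ⟨h1, hv⟩⟩
      · rw [if_neg h1] at hv
        exact ⟨e, he, Or.inr ⟨hv, h2⟩⟩
  · rintro ⟨e, he, ⟨h1, h2⟩ | ⟨h1, h2⟩⟩
    · exact ⟨e, ⟨he, Or.inl h1⟩, by rw [if_pos h1]; exact h2⟩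
    · refine ⟨e, ⟨he, Or.inr h2⟩, ?_⟩
      by_cases h3 : (pairs e).1 = u
      · rw [if_pos h3, h2, ← h3]
        exact h1
      · rw [if_neg h3]
        exact h1

omit [Fintype V] in
/-- The open neighbours are the open adjacencies. -/
lemma mem_openNbrs_iff_openAdj {ends : E → Sym2 V} {pairs : E → V × V}
    (hp : ∀ e, ends e = s((pairs e).1, (pairs e).2)) {ω : Config E} {u v : V} :
    v ∈ openNbrs pairs ω u ↔ OpenAdj ends ω u v := by
  rw [mem_openNbrs]
  unfold OpenAdj
  simp only [hp, Sym2.eq_iff]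

omit [Fintype V] in
/-- Soundness of one closure step. -/
lemma conn_of_mem_reachStep {ends : E → Sym2 V} {pairs : E → V × V}
    (hp : ∀ e, ends e = s((pairs e).1, (pairs e).2)) {ω : Config E} {u : V} {S : Finset V}
    (hS : ∀ v ∈ S, Conn ends ω u v) : ∀ v ∈ reachStep pairs ω S, Conn ends ω u v := by
  intro v hv
  unfold reachStep at hv
  rw [Finset.mem_union, Finset.mem_biUnion] at hv
  rcases hv with hv | ⟨u', hu', hv⟩
  · exact hS v hv
  · rw [mem_openNbrs_iff_openAdj hp] at hv
    exact conn_trans (hS u' hu') (conn_of_openAdj hv)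

omit [Fintype V] in
/-- Soundness of the iterated closure. -/
lemma conn_of_mem_iterate {ends : E → Sym2 V} {pairs : E → V × V}
    (hp : ∀ e, ends e = s((pairs e).1, (pairs e).2)) {ω : Config E} {u : V} (n : ℕ) :
    ∀ v ∈ (reachStep pairs ω)^[n] {u}, Conn ends ω u v := by
  induction n with
  | zero =>
    intro v hv
    rw [Function.iterate_zero_apply, Finset.mem_singleton] at hv
    rw [hv]
    exact conn_refl ends ω u
  | succ n ih =>
    rw [Function.iterate_succ_apply']
    exact conn_of_mem_reachStep hp ih

/-- Everything in `reachSet` is connected to `u`. -/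
lemma conn_of_mem_reachSet {ends : E → Sym2 V} {pairs : E → V × V}
    (hp : ∀ e, ends e = s((pairs e).1, (pairs e).2)) {ω : Config E} {u v : V}
    (h : v ∈ reachSet pairs ω u) : Conn ends ω u v :=
  conn_of_mem_iterate hp _ v h

omit [Fintype V] in
/-- A closure step is monotone. -/
lemma reachStep_mono {pairs : E → V × V} {ω : Config E} {S T : Finset V} (h : S ⊆ T) :
    reachStep pairs ω S ⊆ reachStep pairs ω T :=
  Finset.union_subset_union h (Finset.biUnion_subset_biUnion_of_subset_left _ h)

omit [Fintype V] in
/-- A set is contained in its closure step. -/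
lemma subset_reachStep {pairs : E → V × V} {ω : Config E} (S : Finset V) :
    S ⊆ reachStep pairs ω S :=
  Finset.subset_union_left

omit [Fintype V] in
/-- The iterated closure step is monotone in the set. -/
lemma iterate_reachStep_mono {pairs : E → V × V} {ω : Config E} {S T : Finset V} (h : S ⊆ T)
    (n : ℕ) : (reachStep pairs ω)^[n] S ⊆ (reachStep pairs ω)^[n] T := by
  induction n generalizing S T with
  | zero => simpa using h
  | succ n ih =>
    rw [Function.iterate_succ_apply, Function.iterate_succ_apply]
    exact ih (reachStep_mono h)

omit [Fintype V] in
/-- The iterated closure step is monotone in the number of steps. -/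
lemma iterate_reachStep_subset_of_le {pairs : E → V × V} {ω : Config E} (S : Finset V) {m n : ℕ}
    (h : m ≤ n) : (reachStep pairs ω)^[m] S ⊆ (reachStep pairs ω)^[n] S := by
  induction h with
  | refl => exact Finset.Subset.refl _
  | step _ ih =>
    refine ih.trans ?_
    rw [Function.iterate_succ_apply']
    exact subset_reachStep _

omit [Fintype V] in
/-- The end of a walk of length `n` from `u` lies in the `n`-th closure step of `{u}`. -/
lemma mem_iterate_of_walk {ends : E → Sym2 V} {pairs : E → V × V}
    (hp : ∀ e, ends e = s((pairs e).1, (pairs e).2)) {ω : Config E} {u v : V}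
    (p : (openGraph ends ω).Walk u v) : v ∈ (reachStep pairs ω)^[p.length] {u} := by
  induction p with
  | nil => simp
  | @cons a b c h q ih =>
    rw [SimpleGraph.Walk.length_cons, Function.iterate_succ_apply]
    refine iterate_reachStep_mono ?_ q.length ih
    intro x hx
    rw [Finset.mem_singleton] at hx
    rw [hx]
    unfold reachStep
    rw [Finset.mem_union, Finset.mem_biUnion]
    refine Or.inr ⟨a, Finset.mem_singleton_self a, ?_⟩
    rw [mem_openNbrs_iff_openAdj hp]
    exact (openGraph_adj.1 h).2

/-- Everything connected to `u` lies in `reachSet` (through a path of length `< card V`). -/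
lemma mem_reachSet_of_conn {ends : E → Sym2 V} {pairs : E → V × V}
    (hp : ∀ e, ends e = s((pairs e).1, (pairs e).2)) {ω : Config E} {u v : V}
    (h : Conn ends ω u v) : v ∈ reachSet pairs ω u := by
  obtain ⟨p⟩ := h
  have hlt : p.toPath.1.length < Fintype.card V := p.toPath.2.length_lt
  exact iterate_reachStep_subset_of_le {u} hlt.le (mem_iterate_of_walk hp p.toPath.1)

/-- **Computable connectivity**: `u ↔ v` iff `v` lies in the computed open cluster of `u`. -/
theorem conn_iff_mem_reachSet {ends : E → Sym2 V} {pairs : E → V × V}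
    (hp : ∀ e, ends e = s((pairs e).1, (pairs e).2)) {ω : Config E} {u v : V} :
    Conn ends ω u v ↔ v ∈ reachSet pairs ω u :=
  ⟨mem_reachSet_of_conn hp, conn_of_mem_reachSet hp⟩

end ConnReach

end Summit.Ventures.PercRepro2
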